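import Summits.CriticalPhenomena.PercolationContinuityZ3.Theorems.Transplant.SqShadowGluing
import Summits.CriticalPhenomena.PercolationContinuityZ3.Theorems.Transplant.SqShadowCriterion
import Summits.CriticalPhenomena.PercolationContinuityZ3.Theorems.Transplant.HexShadowEq12
import HarnessLib

/-!
# SQUARE SHADOWS XI — eq. (12) from the Gluing Lemma at EVERY density (the degenerate `p = 1` by connectedness), and the end of the chain:
# `θ_v(p_c) = 0` for connected graphs with a square shadow, a.s. uniqueness and the square Gluing Lemma

builds on p205010 (kernel theorem, internal audit signed; external expert review pending) — NOT used in this file.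
Lane `prim-bschramm`, seat `prim-bschramm-p2` (gen 42; class C1b; memo `HOME/bschramm/P2-LATTICES.md` §148); helper file
(`--supports stmt-CriticalPhenomena-4575 --as helper`).  Hexagonal twin «HexShadowEq12» (whose generic `HexShadow.relabel_edgeSet_eq`, `HexShadow.lt_one_or_eq_one` are reused).
* §1 the density `p = 1` (where `P_1 = δ_{E(G)}` and the node `SqGluing` is not available): for a CONNECTED graph the conclusion of eq. (12) holds outright at all large admissible
  scales — iterate a lifted unit translation `γ` (`sh ∘ γ = sh + period•e₀`) on a fixed path from a vertex `a₀` of least shadow radius to `γ a₀`; the `j`-fold concatenation joins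
  `a₀ ∈ \overline{sqBall c u_{3n}}` to `γ^j a₀ ∈ \overline{sqBall (c + 2n e₀) u_n}` inside `\overline{sqBall c 4n}` once `2n = j·period ≥ 2R` (`eq12_at_one`);
* §2 **`eq12Likely4_of_sqGluing : G.Connected → Ψ.SqGluing → Ψ.Eq12Likely4`** (§1 and «SqShadowGluing»);
* §3 **`theta_criticalProb_eq_zero_of_sqGluing`** (connected + a.s. uniqueness + `SqGluing` ⇒ `θ_v(p_c) = 0` at every vertex): Duminil-Copin–Sidoravicius–Tassion's Theorem 1 for
  an abstract square shadow, MODULO THE GLUING LEMMA 6 ALONE — eq. (1), Lemmata 4–5, eqs. (10)–(13), §2.2 and the finite-size criterion are PROVED in the tree.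
[cite: DuminilCopinSidoraviciusTassion2016, Thm. 1, §2.1 eq. (12), Lemma 6] [cite: BenjaminiSchramm1996, Conj. 4 / Question 3]
-/

noncomputable section

namespace Summit.CriticalPhenomena.PercolationContinuityZ3.Theorems.Transplant

open MeasureTheory Literature.Probability.Percolation Literature.Probability.LatticeModels SimpleGraph Filter
open scoped Classical Topology

namespace SqShadow

variable {V : Type} {G : SimpleGraph V} (Ψ : SqShadow G)

/-! ## §1 The density `p = 1`: eq. (12) by connectedness -/

/-- **Transport of a sure connection along a lifted translation**: if `E(G)` joins `x` to `y` inside `\overline{sqBall z r}` and `sh ∘ γ = sh + d`, then `E(G)` joins `γ x` to `γ y`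
inside `\overline{sqBall (z + d) r}`. [folklore] -/
theorem edgeSet_openConnIn_shift (γ : G ≃g G) {d : Site 2} (hγ : ∀ w, Ψ.sh (γ w) = Ψ.sh w + d) {z : Site 2} {r : ℕ} {x y : V}
    (h : G.edgeSet ∈ openConnIn (Ψ.lift (sqBall z r)) x y) : G.edgeSet ∈ openConnIn (Ψ.lift (sqBall (z + d) r)) (γ x) (γ y) := by
  have hγg : ∀ w, Ψ.sh (γ w) = Equiv.addRight d (Ψ.sh w) := fun w => by rw [Equiv.coe_addRight, hγ]
  rw [← image_addRight_sqBall d z r, ← Ψ.image_lift γ (Equiv.addRight d) hγg, ← HexShadow.relabel_edgeSet_eq γ]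
  exact (relabel_mem_openConnIn_iff γ.toEquiv G.edgeSet (Ψ.lift (sqBall z r)) x y).2 h

/-- **Iterating a lifted unit translation**: with `sh ∘ γ = sh + period•e₀` and `E(G)` joining `a` to `γ a` inside `\overline{sqBall c R}`, the `j`-th iterate `γ^[j] a` lies over
`sh a + (j·period)•e₀` and is joined to `a` inside `\overline{sqBall c (R + j·period)}`. [folklore] -/
theorem iterate_shift_openConnIn (γ : G ≃g G) (hγ : ∀ w, Ψ.sh (γ w) = Ψ.sh w + (Ψ.period : ℤ) • (Pi.single 0 1 : Site 2)) {a : V} {R : ℕ}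
    (h : G.edgeSet ∈ openConnIn (Ψ.lift (sqBall Ψ.centre R)) a (γ a)) (j : ℕ) :
    Ψ.sh (γ^[j] a) = Ψ.sh a + ((j : ℤ) * Ψ.period) • (Pi.single 0 1 : Site 2) ∧
      G.edgeSet ∈ openConnIn (Ψ.lift (sqBall Ψ.centre (R + j * Ψ.period))) a (γ^[j] a) := by
  induction j with
  | zero =>
    refine ⟨by simp, ?_⟩
    simp only [Function.iterate_zero, id_eq, zero_mul, add_zero]
    have ha : a ∈ Ψ.lift (sqBall Ψ.centre R) := (mem_openConnIn_iff_pathIn.1 h).left_mem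
    exact mem_openConnIn_iff_pathIn.2 (PathIn.refl ha)
  | succ j ih =>
    obtain ⟨hsh, hconn⟩ := ih
    refine ⟨?_, ?_⟩
    · rw [Function.iterate_succ_apply', hγ, hsh, add_assoc, ← add_smul]; push_cast; ring_nf
    · -- transport `a ⟶ γ^[j] a` by `γ`, prepend `a ⟶ γ a`
      have h1 := Ψ.edgeSet_openConnIn_shift γ hγ hconn
      rw [Function.iterate_succ_apply']
      have hsub1 : Ψ.lift (sqBall Ψ.centre R) ⊆ Ψ.lift (sqBall Ψ.centre (R + (j + 1) * Ψ.period)) := Ψ.lift_mono (sqBall_mono _ (by nlinarith))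
      have hsub2 : Ψ.lift (sqBall (Ψ.centre + (Ψ.period : ℤ) • (Pi.single 0 1 : Site 2)) (R + j * Ψ.period)) ⊆
          Ψ.lift (sqBall Ψ.centre (R + (j + 1) * Ψ.period)) := by
        refine Ψ.lift_mono fun w hw => ?_
        rw [mem_sqBall_iff_linear] at hw ⊢
        simp only [Pi.add_apply, smul_single_apply] at hw
        simp at hw
        push_cast at hw ⊢
        have : (0 : ℤ) ≤ Ψ.period := by positivity
        refine ⟨?_, ?_, ?_, ?_⟩ <;> nlinarith
      exact SlabCriticality.openConnIn_trans (openConnIn_mono hsub1 _ _ h) (openConnIn_mono hsub2 _ _ h1)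

/-- **EQ. (12) AT `p = 1` for a connected graph** (conclusion of `Eq12Likely4` with `s = 0`, at every large admissible `n`): sure connections along the iterated unit translation
from a vertex of least shadow radius. [cite: DuminilCopinSidoraviciusTassion2016, §2.1 eq. (12)] -/
theorem eq12_at_one [Countable V] (hG : G.Connected) {v : V} {u : ℕ → ℕ}
    (hlim : Tendsto (fun n => (bondPercolation G 1).real (Ψ.uniqueConn (sqBall Ψ.centre n) (sqBall Ψ.centre (u n)) (sqRing Ψ.centre n))) atTop (𝓝 1))
    (ε : ℝ) (hε : 0 < ε) (N : ℕ) :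
    ∃ n : ℕ, N ≤ n ∧ Ψ.period ∣ n ∧ ∃ s : ℤ, -(3 * (n : ℤ)) ≤ Ψ.period * s ∧ (Ψ.period : ℤ) * s ≤ 3 * n ∧
      1 - ε < (bondPercolation G 1).real (Ψ.conn (sqBall Ψ.centre (4 * n)) (sqBall Ψ.centre (u (3 * n)))
        (sqBall (Ψ.centre + (2 * (n : ℤ)) • Pi.single 0 1 + ((Ψ.period : ℤ) * s) • Pi.single 1 1) (u n))) := by
  haveI : Nonempty V := ⟨v⟩
  set c := Ψ.centre with hc
  have hP1 : bondPercolation G 1 = Measure.dirac G.edgeSet := by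
    rw [show bondPercolation G 1 = ProbabilityTheory.setBernoulli G.edgeSet 1 from rfl, ProbabilityTheory.setBernoulli_one]
  -- eventually the inner lift is nonempty
  have hne : ∀ᶠ n in atTop, (Ψ.lift (sqBall c (u n))).Nonempty := by
    have hev := hlim.eventually (Ioi_mem_nhds (show (0 : ℝ) < 1 by norm_num))
    refine hev.mono fun n hn => ?_
    by_contra hemp
    rw [Set.not_nonempty_iff_eq_empty] at hemp
    have h0 : Ψ.uniqueConn (sqBall c n) (sqBall c (u n)) (sqRing c n) = ∅ := by
      ext ω
      simp only [uniqueConn, conn, mem_openCrossing_iff, Set.mem_setOf_eq, Set.mem_empty_iff_false, iff_false, not_and]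
      intro hh
      obtain ⟨x, hx, -⟩ := hh
      rw [hemp] at hx
      exact absurd hx (Set.notMem_empty x)
    have : (0 : ℝ) < (bondPercolation G 1).real (Ψ.uniqueConn (sqBall c n) (sqBall c (u n)) (sqRing c n)) := hn
    rw [h0, measureReal_empty] at this
    exact lt_irrefl _ this
  obtain ⟨N₁, hN₁⟩ := Filter.eventually_atTop.1 hne
  -- a vertex of least shadow radius
  set f : V → ℕ := fun a => (max |Ψ.sh a 0 - c 0| |Ψ.sh a 1 - c 1|).toNat with hf
  set a₀ : V := Function.argmin f with ha₀
  have hmin : ∀ n, N₁ ≤ n → a₀ ∈ Ψ.lift (sqBall c (u n)) := by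
    intro n hn
    obtain ⟨a, ha⟩ := hN₁ n hn
    rw [mem_lift, mem_sqBall] at ha ⊢
    have h1 : f a₀ ≤ f a := Function.argmin_le f a
    have h2 : (f a : ℤ) = max |Ψ.sh a 0 - c 0| |Ψ.sh a 1 - c 1| := Int.toNat_of_nonneg (le_max_of_le_left (abs_nonneg _))
    have h3 : (f a₀ : ℤ) = max |Ψ.sh a₀ 0 - c 0| |Ψ.sh a₀ 1 - c 1| := Int.toNat_of_nonneg (le_max_of_le_left (abs_nonneg _))
    have h4 : (f a₀ : ℤ) ≤ f a := by exact_mod_cast h1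
    have h5 : max |Ψ.sh a 0 - c 0| |Ψ.sh a 1 - c 1| ≤ (u n : ℤ) := max_le ha.1 ha.2
    have h6 : max |Ψ.sh a₀ 0 - c 0| |Ψ.sh a₀ 1 - c 1| ≤ (u n : ℤ) := by linarith
    exact ⟨(le_max_left _ _).trans h6, (le_max_right _ _).trans h6⟩
  -- the unit translation and a sure path from `a₀` to `γ a₀`
  obtain ⟨γ, hγ⟩ := Ψ.shift (Pi.single 0 1)
  have hreach : (openGraph G.edgeSet).Reachable a₀ (γ a₀) := by
    rw [show openGraph G.edgeSet = G from SimpleGraph.fromEdgeSet_edgeSet G]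
    exact hG a₀ (γ a₀)
  obtain ⟨R, hR⟩ := Filter.eventually_atTop.1 (Ψ.eventually_openConnIn_of_reachable hreach)
  have hpath := Ψ.iterate_shift_openConnIn γ hγ (hR R le_rfl)
  -- the scale: `n = period * M` with `M` large
  set M : ℕ := max (max N N₁) (max R 1) with hM
  refine ⟨Ψ.period * M, ?_, ⟨M, rfl⟩, 0, by rw [mul_zero, neg_nonpos]; positivity, by rw [mul_zero]; positivity, ?_⟩
  · have : 1 ≤ Ψ.period := Ψ.period_pos
    have : N ≤ M := (le_max_left _ _).trans (le_max_left _ _)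
    nlinarith
  have hPp : 1 ≤ Ψ.period := Ψ.period_pos
  have hM1 : 1 ≤ M := (le_max_right _ _).trans (le_max_right _ _)
  have hMR : R ≤ M := (le_max_left _ _).trans (le_max_right _ _)
  have hMN₁ : N₁ ≤ M := (le_max_right _ _).trans (le_max_left _ _)
  set n : ℕ := Ψ.period * M with hn
  have hMn : M ≤ n := by rw [hn]; nlinarith
  -- the sure connection at `j = 2M`
  obtain ⟨hsh, hconn⟩ := hpath (2 * M)
  have hmem : G.edgeSet ∈ Ψ.conn (sqBall c (4 * n)) (sqBall c (u (3 * n)))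
      (sqBall (c + (2 * (n : ℤ)) • Pi.single 0 1 + ((Ψ.period : ℤ) * 0) • Pi.single 1 1) (u n)) := by
    refine ⟨a₀, hmin (3 * n) (hMN₁.trans (hMn.trans (by omega))), γ^[2 * M] a₀, ?_, openConnIn_mono (Ψ.lift_mono (sqBall_mono _ ?_)) _ _ hconn⟩
    · have := hmin n (hMN₁.trans hMn)
      rw [mem_lift, mem_sqBall_iff_linear] at this ⊢
      rw [hsh, mul_zero, zero_smul, add_zero]
      simp only [Pi.add_apply, smul_single_apply]
      simp
      rw [hn]; push_cast
      refine ⟨?_, ?_, ?_, ?_⟩ <;> nlinarith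
    · rw [hn]; nlinarith
  rw [hP1, measureReal_def, Measure.dirac_apply_of_mem hmem]
  simp only [ENNReal.toReal_one]
  linarith

/-! ## §2 Eq. (12) at every density -/

/-- **`Eq12Likely4` FROM THE SQUARE GLUING LEMMA** for a connected graph: `p < 1` by «SqShadowGluing» (Lemmata 4, 5, eqs. (10)–(11) and the node), `p = 1` by connectedness (§1).
[cite: DuminilCopinSidoraviciusTassion2016, §2.1 eq. (12)] -/
theorem eq12Likely4_of_sqGluing [Countable V] (hG : G.Connected) (h6 : Ψ.SqGluing) : Ψ.Eq12Likely4 := by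
  intro v p hθ u hu4 hlim ε hε N
  rcases HexShadow.lt_one_or_eq_one p with hp | hp
  · exact Ψ.eq12_of_sqGluing_lt_one h6 hθ hp hu4 hlim ε hε N
  · subst hp
    exact Ψ.eq12_at_one hG (v := v) hlim ε hε N

/-! ## §3 The end of the chain -/

/-- **`θ_v(p_c) = 0` FROM THE SQUARE GLUING LEMMA**: a connected graph with a square shadow, a.s. uniqueness of the infinite cluster at every density and the Gluing Lemma `SqGluing`
dies at its own critical point at every vertex.  (Duminil-Copin–Sidoravicius–Tassion's Theorem 1 for an abstract square shadow: eq. (1), Lemmata 4–5, eqs. (10)–(13), §2.2 and the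
finite-size criterion are PROVED in the tree; Lemma 6 is the hypothesis.) [cite: DuminilCopinSidoraviciusTassion2016, Thm. 1 and §2] [cite: BenjaminiSchramm1996, Conj. 4 / Question 3] -/
theorem theta_criticalProb_eq_zero_of_sqGluing [Countable V] (hG : G.Connected)
    (hU : ∀ p : unitInterval, ∀ᵐ ω ∂(bondPercolation G p), numInfiniteClusters ω ≤ 1) (h6 : Ψ.SqGluing) (v : V) :
    theta G v (criticalProbIOf G v) = 0 :=
  Ψ.theta_criticalProb_eq_zero_of_eq12Likely4 hG hU (Ψ.eq12Likely4_of_sqGluing hG h6) v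

end SqShadow

end Summit.CriticalPhenomena.PercolationContinuityZ3.Theorems.Transplant

end
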